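import Summits.ABC.StewartYu.GenThreeStepArchWK
import Summits.ABC.StewartYu.GenThreeFrameSpecArchW
import HarnessLib

/-!
# Cell abc-stewartyu, WP-L.A shell (parcel P-A1): reductions, base ranks and FRAME SPEC for the Kummer-carrying
# pivot-weighted induction — design B stage 1 (`ArchCoreKummer`) end to end

`Summits/ABC/StewartYu/GenThreeFrameSpecArchWK.lean` — cell `abc-stewartyu` (HOME `run/shared/lean/pub/abc-stewartyu/`),
route `YuMatveevShapeRat` (rung A1.L, crux r2 `ArchCoreRat`, stmt-ABC-20502), seat p4 (g9), parcel WP-L.A P-A1; the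
Kummer-carrying twin of `GenThreeReduceArchW` + `GenThreeBaseArchW` + `GenThreeFrameSpecArchW` in one file.
One plain `Prop`-valued definition (`FrameArchWKRat`) and theorems.

What the design-B frame (p5 `ArchG3*`, lp-1 `ArchLvInv`/`ArchG3KStep*`, p1 `ArchG3Par`) owes for the
Kummer-CONDITIONAL archimedean core: `FrameArchWKRat C Y n` — for every REDUCED rank-`n` datum (all `bⱼ ≠ 0`,
`gcd b = 1`, weights sorted, pivot `k₀` at a maximal weight, `|bⱼ|Aⱼ ≤ B·A_{k₀}`) of positive independent
rationals WITH INDEPENDENT SQUARE CLASSES (both forms supplied: `∏ aⱼ^{κⱼ} = γ² ⇒ 2 ∣ κ` and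
`∀ T ≠ ∅, ¬ IsSquare (∏_{j∈T} aⱼ)` — the hypothesis of `Waldschmidt1980Liouville.abs_ev_ge_sharp`), under the
negated bound (2.14) and in the regime (2.6): a pivot `j₀` and letters with the RATIONAL-POINT frame output
`FrameOutputTwo n a b j₀ D₀ S₀ X D` and the record obligations `RecordArchW C Y n A D₀ S₀ X D` (the SAME record
predicate as the Kummer-free spec).  Then `archCoreKummer_of_frameWKRat_two_le_pow`: the crux text with ONE extra
2-Kummer clause, from the frame at ranks `≥ 2` (slack `Y` per rank), `2 ≤ c`, and the zero estimate.

Contents: `kummer_perm`, `not_isSquare_prod_of_kummer`, `stepArchWK_of_log_le`, `stepArchWK_perm`,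
`stepArchWK_of_exists_eq_zero`, `stepArchWK_of_stepArchWK_smul`, `dichotomyArchWK_of_reduced`, `coreArchWK_zero`,
`coreArchWK_one`, `dichotomyArchWK_all`, `FrameArchWKRat`, `dichotomyArchWK_of_frameRat`,
`archCoreKummer_of_frameWKRat_two_le_pow`.

WHAT THIS IS NOT: no analytic content; no crux moves; `ArchCoreKummer` is not a route item (stage-1 theorem).

References: Yu. V. Nesterenko, LNM 1819 (2003), §2 p. 56, (2.6), (2.14), §4.3 Lemma 4.4/Cor. 4.5, §5.2;
E. M. Matveev, Izv. Math. 64 (2000), (1.3); M. Waldschmidt, Acta Arith. 37 (1980), Lemma 2.2.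
-/

noncomputable section

open Finset
open Literature.NumberTheory.Transcendental
open Literature.NumberTheory.Transcendental.GaGm

namespace Summit.ABC.StewartYu.GenThreeFrameSpecArchWK

open Summit.ABC.StewartYu.GenThreeInductionArch
open Summit.ABC.StewartYu.GenThreeInductionArchW
open Summit.ABC.StewartYu.GenThreeInductionArchWK
open Summit.ABC.StewartYu.GenThreeStepArchWK (stepArchWK_of_exitC)
open Summit.ABC.StewartYu.GenThreeBaseArch (regime_of_not_le coreArch_one)
open Summit.ABC.StewartYu.GenThreeReduceArch (linearForm_perm prod_perm indep_perm comp_perm_ne_zero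
  linearForm_smul log_abs_linearForm_le_of_smul exists_primitive)
open Summit.ABC.StewartYu.GenThreeFrameSpecTwo (bHyperplane mem_bHyperplane FrameOutputTwo)
open Summit.ABC.StewartYu.GenThreeFrameSpecArchW (RecordArchW)
open Summit.ABC.StewartYu.GenThreeEndExits (exists_exits_rat span_rat_of_exitC pos_of_exitC)

variable {n : ℕ}

/-! ### Kummer bookkeeping -/

/-- The 2-Kummer clause is invariant under relabelling. [folklore] -/
theorem kummer_perm (σ : Equiv.Perm (Fin n)) (a : Fin n → ℚ)
    (hK : ∀ κ : Fin n → ℤ, (∃ γ : ℚ, ∏ j, a j ^ κ j = γ ^ 2) → ∀ j, (2 : ℤ) ∣ κ j) :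
    ∀ κ : Fin n → ℤ, (∃ γ : ℚ, ∏ j, a (σ j) ^ κ j = γ ^ 2) → ∀ j, (2 : ℤ) ∣ κ j := by
  intro κ hκ
  obtain ⟨γ, hγ⟩ := hκ
  have h1 : ∏ j, a j ^ κ (σ.symm j) = γ ^ 2 := by
    rw [← Equiv.prod_comp σ (fun j => a j ^ κ (σ.symm j))]
    simpa only [Equiv.symm_apply_apply] using hγ
  have h2 := hK (fun j => κ (σ.symm j)) ⟨γ, h1⟩
  intro i
  have h3 := h2 (σ i)
  simpa only [Equiv.symm_apply_apply] using h3

/-- **Divisibility form ⇒ subset form** for positive rationals: if `∏ aⱼ^{κⱼ} = γ² ⇒ 2 ∣ κ`, then no product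
`∏_{j∈T} aⱼ` over a nonempty `T` is a square (the hypothesis of `Waldschmidt1980Liouville.abs_ev_ge_sharp`).
[cite: Nesterenko2003, Cor 4.5 (p. 94); folklore dictionary] -/
theorem not_isSquare_prod_of_kummer (a : Fin n → ℚ)
    (hK : ∀ κ : Fin n → ℤ, (∃ γ : ℚ, ∏ j, a j ^ κ j = γ ^ 2) → ∀ j, (2 : ℤ) ∣ κ j) :
    ∀ T : Finset (Fin n), T.Nonempty → ¬ IsSquare (∏ j ∈ T, a j) := by
  classical
  intro T hT hsq
  obtain ⟨γ, hγ⟩ := hsq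
  set φ : Fin n → ℤ := fun j => if j ∈ T then 1 else 0 with hφ
  have hprod : ∏ j, a j ^ φ j = ∏ j ∈ T, a j := by
    rw [← Finset.prod_filter_mul_prod_filter_not Finset.univ (fun j => j ∈ T)]
    have h1 : Finset.univ.filter (fun j => j ∈ T) = T := by ext j; simp
    have h2 : ∏ j ∈ Finset.univ.filter (fun j => ¬ j ∈ T), a j ^ φ j = 1 :=
      Finset.prod_eq_one fun j hj => by
        simp only [Finset.mem_filter, Finset.mem_univ, true_and] at hj
        simp [hφ, hj]
    rw [h2, mul_one, h1]
    exact Finset.prod_congr rfl fun j hj => by simp [hφ, hj]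
  obtain ⟨j, hj⟩ := hT
  have h := hK φ ⟨γ, by rw [hprod, hγ, sq]⟩ j
  simp [hφ, hj] at h

/-! ### The reductions, Kummer-carrying -/

/-- Monotonicity of the Kummer-carrying step in the old linear form. [cite: Nesterenko2003, Prop 2.6 (2.10)] -/
theorem stepArchWK_of_log_le {C : ℕ → ℝ} {a : Fin n → ℚ} {b b' : Fin n → ℤ} {A : Fin n → ℝ} {B : ℝ}
    (h : StepArchWK C n a b' A B)
    (hle : Real.log |∑ j, (b' j : ℝ) * Real.log (a j : ℝ)| ≤ Real.log |∑ j, (b j : ℝ) * Real.log (a j : ℝ)|) :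
    StepArchWK C n a b A B := by
  obtain ⟨r, θ, m, A', B', i₀, D, hr, hθ, hindθ, hKθ, hA', hA1', hm, hB', hcmp, hcost⟩ := h
  exact ⟨r, θ, m, A', B', i₀, D, hr, hθ, hindθ, hKθ, hA', hA1', hm, hB', hcmp.trans hle, hcost⟩

/-- Permutation invariance of the Kummer-carrying step. [cite: Nesterenko2003, §2 p. 56] -/
theorem stepArchWK_perm {C : ℕ → ℝ} (σ : Equiv.Perm (Fin n)) {a : Fin n → ℚ} {b : Fin n → ℤ} {A : Fin n → ℝ}
    {B : ℝ} (h : StepArchWK C n (fun j => a (σ j)) (fun j => b (σ j)) (fun j => A (σ j)) B) :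
    StepArchWK C n a b A B := by
  obtain ⟨r, θ, m, A', B', i₀, D, hr, hθ, hindθ, hKθ, hA', hA1', hm, hB', hcmp, hcost⟩ := h
  rw [linearForm_perm σ a b] at hcmp
  rw [prod_perm σ A] at hcost
  exact ⟨r, θ, m, A', B', i₀, D, hr, hθ, hindθ, hKθ, hA', hA1', hm, hB', hcmp, hcost⟩

/-- `(a, b′) ↦ (a, d·b′)` for the Kummer-carrying step. [cite: Nesterenko2003, Lemma 5.2] -/
theorem stepArchWK_of_stepArchWK_smul {C : ℕ → ℝ} {a : Fin n → ℚ} {b' : Fin n → ℤ} {A : Fin n → ℝ} {B : ℝ}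
    {d : ℤ} (hd : d ≠ 0) (h : StepArchWK C n a b' A B) :
    StepArchWK C n a (fun j => d * b' j) A B :=
  stepArchWK_of_log_le h (log_abs_linearForm_le_of_smul a hd b')

/-- **Zero-coordinate deletion as a Kummer-carrying step** (pivot kept; the restriction stays 2-Kummer by
`kummer_restrict`). [cite: Nesterenko2003, §2 p. 56] -/
theorem stepArchWK_of_exists_eq_zero {C : ℕ → ℝ} (hC0 : 0 ≤ C n) (hCmono : ∀ r, r < n → C r ≤ C n)
    {a : Fin n → ℚ} {b : Fin n → ℤ} {A : Fin n → ℝ} {B : ℝ} {k₀ : Fin n}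
    (ha : ∀ j, 0 < a j) (hind : ∀ μ : Fin n → ℤ, ∏ j, a j ^ μ j = 1 → μ = 0)
    (hK : ∀ κ : Fin n → ℤ, (∃ γ : ℚ, ∏ j, a j ^ κ j = γ ^ 2) → ∀ j, (2 : ℤ) ∣ κ j)
    (hA : ∀ j, Height.logHeight₁ (a j) ≤ A j) (hA1 : ∀ j, 1 ≤ A j) (hk₀ : b k₀ ≠ 0)
    (hBw : ∀ j, (|b j| : ℝ) * A j ≤ B * A k₀) (hk : ∃ k, b k = 0) :
    StepArchWK C n a b A B := by
  -- same construction as `GenThreeReduceArchW.stepArchW_of_exists_eq_zero` (whose witnesses are hidden by the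
  -- `∃`), with the Kummer clause of the restriction supplied by `kummer_restrict`
  classical
  set s : Finset (Fin n) := Finset.univ.filter fun j => b j ≠ 0 with hs
  set r : ℕ := s.card with hrdef
  obtain ⟨k, hk⟩ := hk
  have hks : k ∉ s := by simp [hs, hk]
  have hk₀s : k₀ ∈ s := by simp [hs, hk₀]
  have hrn : r < n := by
    have h1 : s.card < (Finset.univ : Finset (Fin n)).card :=
      Finset.card_lt_card ⟨Finset.subset_univ _, fun h => hks (h (Finset.mem_univ k))⟩
    simpa [hrdef] using h1
  set e : Fin r ≃ s := s.equivFin.symm with he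
  set emb : Fin r → Fin n := fun i => (e i : Fin n) with hemb
  have hembinj : Function.Injective emb := fun i i' h => e.injective (Subtype.ext h)
  set θ : Fin r → ℚ := fun i => a (emb i) with hθdef
  set m : Fin r → ℤ := fun i => b (emb i) with hmdef
  set A' : Fin r → ℝ := fun i => A (emb i) with hA'def
  set i₀ : Fin r := e.symm ⟨k₀, hk₀s⟩ with hi₀def
  have hei₀ : emb i₀ = k₀ := by simp [hemb, hi₀def]
  have hreidx : ∀ (f : Fin n → ℚ), ∏ i, f (emb i) = ∏ j ∈ s, f j := by
    intro f
    rw [show (fun i => f (emb i)) = fun i => (fun x : s => f x) (e i) from rfl, Equiv.prod_comp e (fun x : s => f x),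
      Finset.prod_coe_sort]
  have hreidxR : ∀ (f : Fin n → ℝ), ∏ i, f (emb i) = ∏ j ∈ s, f j := by
    intro f
    rw [show (fun i => f (emb i)) = fun i => (fun x : s => f x) (e i) from rfl, Equiv.prod_comp e (fun x : s => f x),
      Finset.prod_coe_sort]
  have hrel : ∏ i, θ i ^ m i = (∏ j, a j ^ b j) ^ (1 : ℤ) := by
    rw [zpow_one]
    have h1 : ∏ i, θ i ^ m i = ∏ j ∈ s, a j ^ b j := by
      simpa [hθdef, hmdef] using hreidx (fun j => a j ^ b j)
    rw [h1]
    exact Finset.prod_filter_of_ne fun j _ hj => by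
      intro hbj; apply hj; rw [hbj, zpow_zero]
  have hindθ : ∀ μ : Fin r → ℤ, ∏ i, θ i ^ μ i = 1 → μ = 0 := by
    intro μ hμ
    set μ' : Fin n → ℤ := fun j => if h : j ∈ s then μ (e.symm ⟨j, h⟩) else 0 with hμ'
    have h1 : ∏ j, a j ^ μ' j = 1 := by
      have h2 : ∏ j, a j ^ μ' j = ∏ j ∈ s, a j ^ μ' j := by
        symm
        exact Finset.prod_filter_of_ne fun j _ hj => by
          by_contra hjs
          apply hj
          have : μ' j = 0 := by simp [hμ', hs] at hjs ⊢; intro h; exact absurd hjs h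
          rw [this, zpow_zero]
      rw [h2, ← hreidx (fun j => a j ^ μ' j)]
      have h3 : ∀ i, a (emb i) ^ μ' (emb i) = θ i ^ μ i := by
        intro i
        have hmem : emb i ∈ s := (e i).2
        have : μ' (emb i) = μ i := by
          simp only [hμ', hmem, dite_true]
          congr 1
          have : (⟨emb i, hmem⟩ : s) = e i := Subtype.ext rfl
          rw [this, Equiv.symm_apply_apply]
        rw [this]
      rw [Finset.prod_congr rfl fun i _ => h3 i]
      exact hμ
    have h4 := hind μ' h1
    funext i
    have h5 := congrFun h4 (emb i)
    have hmem : emb i ∈ s := (e i).2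
    simp only [hμ', hmem, dite_true, Pi.zero_apply] at h5
    have : (⟨emb i, hmem⟩ : s) = e i := Subtype.ext rfl
    rw [this, Equiv.symm_apply_apply] at h5
    exact h5
  have hKθ := kummer_restrict a hK emb hembinj
  have hprodle : ∏ i, A' i ≤ ∏ j, A j := by
    have h1 : ∏ i, A' i = ∏ j ∈ s, A j := by simpa [hA'def] using hreidxR A
    rw [h1, ← Finset.prod_filter_mul_prod_filter_not Finset.univ (fun j => b j ≠ 0) A]
    have h2 : 1 ≤ ∏ j ∈ Finset.univ.filter (fun j => ¬ b j ≠ 0), A j :=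
      Finset.one_le_prod fun j _ => hA1 j
    have h3 : 0 ≤ ∏ j ∈ s, A j := Finset.prod_nonneg fun j _ => by linarith [hA1 j]
    calc ∏ j ∈ s, A j = (∏ j ∈ s, A j) * 1 := (mul_one _).symm
      _ ≤ (∏ j ∈ s, A j) * ∏ j ∈ Finset.univ.filter (fun j => ¬ b j ≠ 0), A j :=
          mul_le_mul_of_nonneg_left h2 h3
  have hmi₀ : m i₀ ≠ 0 := by simp only [hmdef]; rw [hei₀]; exact hk₀
  have hBw' : ∀ i, (|m i| : ℝ) * A' i ≤ B * A' i₀ := by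
    intro i; simp only [hmdef, hA'def]; rw [hei₀]; exact hBw _
  have hB1 : 1 ≤ B := one_le_boundW hA1 hk₀ hBw
  have hlogB : 0 ≤ Real.log (Real.exp 1 * B) := zero_le_one.trans (one_le_log_exp_one_mul hB1)
  have hcost : C r * (∏ i, A' i) * Real.log (Real.exp 1 * B) + Real.log |((1 : ℤ) : ℝ)| ≤
      C n * (∏ j, A j) * Real.log (Real.exp 1 * B) := by
    have h0 : Real.log |((1 : ℤ) : ℝ)| = 0 := by simp
    rw [h0, add_zero]
    have hA'0 : 0 ≤ ∏ i, A' i := Finset.prod_nonneg fun i _ => by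
      have := hA1 (emb i); simp only [hA'def]; linarith
    have h1 : C r * (∏ i, A' i) ≤ C n * (∏ j, A j) :=
      calc C r * (∏ i, A' i) ≤ C n * (∏ i, A' i) := mul_le_mul_of_nonneg_right (hCmono r hrn) hA'0
        _ ≤ C n * (∏ j, A j) := mul_le_mul_of_nonneg_left hprodle hC0
    exact mul_le_mul_of_nonneg_right h1 hlogB
  exact stepArchWK_of_pow_eq ha hrn θ m A' B i₀ (fun i => ha _) hindθ hKθ (fun i => hA _) (fun i => hA1 _)
    hmi₀ hBw' 1 one_ne_zero hrel hcost

/-- **`DichotomyArchWK C n` from the Kummer-carrying STEP on REDUCED data under the negated bound** (twin of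
`GenThreeReduceArchW.dichotomyArchW_of_reduced`; the frame additionally receives the subset form of the 2-Kummer
clause). [cite: Nesterenko2003, §2 p. 56, (2.6), (2.14), Lemma 5.2, Cor 4.5] -/
theorem dichotomyArchWK_of_reduced {C : ℕ → ℝ} (hC0 : 0 ≤ C n) (hCmono : ∀ r, r < n → C r ≤ C n)
    (h : ∀ (a : Fin n → ℚ) (b : Fin n → ℤ) (A : Fin n → ℝ) (B : ℝ) (k₀ : Fin n),
      (∀ j, 0 < a j) →
      (∀ μ : Fin n → ℤ, ∏ j, a j ^ μ j = 1 → μ = 0) →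
      (∀ κ : Fin n → ℤ, (∃ γ : ℚ, ∏ j, a j ^ κ j = γ ^ 2) → ∀ j, (2 : ℤ) ∣ κ j) →
      (∀ T : Finset (Fin n), T.Nonempty → ¬ IsSquare (∏ j ∈ T, a j)) →
      (∀ j, Height.logHeight₁ (a j) ≤ A j) → (∀ j, 1 ≤ A j) →
      (∀ j, b j ≠ 0) → Finset.univ.gcd b = 1 → Monotone A → (∀ j, A j ≤ A k₀) →
      (∀ j, (|b j| : ℝ) * A j ≤ B * A k₀) →
      ¬ -(C n * (∏ j, A j) * Real.log (Real.exp 1 * B)) ≤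
          Real.log |∑ j, (b j : ℝ) * Real.log (a j : ℝ)| →
      C n * (∏ j, A j) * Real.log (Real.exp 1 * B) < ∑ j, A j * |(b j : ℝ)| + Real.log 2 →
      StepArchWK C n a b A B) :
    DichotomyArchWK C n := by
  classical
  intro a b A B k₀ ha hind hK hA hA1 hk₀ hBw
  by_cases hz : ∃ k, b k = 0
  · exact Or.inr (stepArchWK_of_exists_eq_zero hC0 hCmono ha hind hK hA hA1 hk₀ hBw hz)
  push Not at hz
  set σ : Equiv.Perm (Fin n) := Tuple.sort A with hσ
  have hmono : Monotone (fun j => A (σ j)) := Tuple.monotone_sort A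
  set a₁ : Fin n → ℚ := fun j => a (σ j) with ha₁
  set b₁ : Fin n → ℤ := fun j => b (σ j) with hb₁
  set A₁ : Fin n → ℝ := fun j => A (σ j) with hA₁
  have hn : 0 < n := Fin.pos k₀
  set k₁ : Fin n := ⟨n - 1, by omega⟩ with hk₁
  have hk₁max : ∀ j, A₁ j ≤ A₁ k₁ := fun j => hmono (Fin.mk_le_mk.mpr (by have := j.2; omega))
  have ha' : ∀ j, 0 < a₁ j := fun j => ha _
  have hind' := indep_perm σ a hind
  have hK' := kummer_perm σ a hK
  have hA' : ∀ j, Height.logHeight₁ (a₁ j) ≤ A₁ j := fun j => hA _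
  have hA1' : ∀ j, 1 ≤ A₁ j := fun j => hA1 _
  have hbz' : ∀ j, b₁ j ≠ 0 := fun j => hz _
  have hB1 : 1 ≤ B := one_le_boundW hA1 hk₀ hBw
  have hAk₀le : A k₀ ≤ A₁ k₁ := by
    have := hk₁max (σ.symm k₀)
    simpa only [hA₁, Equiv.apply_symm_apply] using this
  have hBw' : ∀ j, (|b₁ j| : ℝ) * A₁ j ≤ B * A₁ k₁ := fun j =>
    (hBw (σ j)).trans (mul_le_mul_of_nonneg_left hAk₀le (by linarith))
  suffices hsuff : -(C n * (∏ j, A₁ j) * Real.log (Real.exp 1 * B)) ≤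
        Real.log |∑ j, (b₁ j : ℝ) * Real.log (a₁ j : ℝ)| ∨ StepArchWK C n a₁ b₁ A₁ B by
    rcases hsuff with hle | hstep
    · left
      rw [show ∏ j, A₁ j = ∏ j, A j from prod_perm σ A,
        show ∑ j, (b₁ j : ℝ) * Real.log (a₁ j : ℝ) = ∑ j, (b j : ℝ) * Real.log (a j : ℝ) from
          linearForm_perm σ a b] at hle
      exact hle
    · exact Or.inr (stepArchWK_perm σ hstep)
  have hb₁ne : b₁ ≠ 0 := fun h0 => hbz' k₁ (by rw [h0]; rfl)
  obtain ⟨d, b₂, hd, hb₂, hdb, hgcd, hle₂⟩ := exists_primitive hb₁ne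
  have hb₂ne : ∀ j, b₂ j ≠ 0 := by
    intro j h0
    apply hbz' j
    rw [hdb j, h0, mul_zero]
  have hBw₂ : ∀ j, (|b₂ j| : ℝ) * A₁ j ≤ B * A₁ k₁ := fun j =>
    le_trans (mul_le_mul_of_nonneg_right (by exact_mod_cast hle₂ j) (by linarith [hA1' j])) (hBw' j)
  have hfun : b₁ = fun j => d * b₂ j := funext hdb
  have hcmp : Real.log |∑ j, (b₂ j : ℝ) * Real.log (a₁ j : ℝ)| ≤
      Real.log |∑ j, (b₁ j : ℝ) * Real.log (a₁ j : ℝ)| := by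
    rw [hfun]
    exact log_abs_linearForm_le_of_smul a₁ hd b₂
  by_cases hbound : -(C n * (∏ j, A₁ j) * Real.log (Real.exp 1 * B)) ≤
      Real.log |∑ j, (b₂ j : ℝ) * Real.log (a₁ j : ℝ)|
  · exact Or.inl (hbound.trans hcmp)
  have hreg := regime_of_not_le a₁ ha' hind' A₁ hA' b₂ hb₂ hbound
  have hstep := h a₁ b₂ A₁ B k₁ ha' hind' hK' (not_isSquare_prod_of_kummer a₁ hK') hA' hA1' hb₂ne hgcd hmono
    hk₁max hBw₂ hbound hreg
  right
  rw [hfun]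
  exact stepArchWK_of_stepArchWK_smul hd hstep

/-! ### Base ranks, Kummer-carrying -/

/-- Rank `0`: vacuous. [folklore] -/
theorem coreArchWK_zero (C : ℕ → ℝ) : CoreArchWK C 0 :=
  fun _ _ _ _ k₀ => Fin.elim0 k₀

/-- Rank `1` (Cor. 2.4; the Kummer clause is not used), for `2 ≤ C 1`. [cite: Nesterenko2003, Cor 2.4 (p. 56)] -/
theorem coreArchWK_one {C : ℕ → ℝ} (hC : 2 ≤ C 1) : CoreArchWK C 1 :=
  coreArchWK_of_coreArchW (GenThreeBaseArchW.coreArchW_one hC)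

/-- The Kummer-carrying dichotomy at every rank from the dichotomy at ranks `≥ 2` and `2 ≤ C 1`. [folklore] -/
theorem dichotomyArchWK_all {C : ℕ → ℝ} (hC1 : 2 ≤ C 1) (hD : ∀ n, 2 ≤ n → DichotomyArchWK C n) :
    ∀ n, DichotomyArchWK C n := by
  intro n
  rcases Nat.lt_or_ge n 2 with hn | hn
  · interval_cases n
    · exact fun _ _ _ _ k₀ => Fin.elim0 k₀
    · exact fun a b A B k₀ ha hind hK hA hA1 hk₀ hBw =>
        Or.inl (coreArchWK_one hC1 a b A B k₀ ha hind hK hA hA1 hk₀ hBw)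
  · exact hD n hn

/-! ### The frame spec (rational points, 2-independent data) and the stage-1 theorem -/

/-- **THE DESIGN-B ARCHIMEDEAN FRAME at rank `n`, Kummer-conditional, rational points**: for every REDUCED rank-`n`
datum with independent square classes (both forms), under the negated bound and in the regime, a pivot `b j₀ ≠ 0`
and letters with `FrameOutputTwo n a b j₀ D₀ S₀ X D` and `RecordArchW C Y n A D₀ S₀ X D`.
[cite: Nesterenko2003, §5; Matveev2000, (1.3); shape only] -/
def FrameArchWKRat (C : ℕ → ℝ) (Y : ℕ → ℝ) (n : ℕ) : Prop :=
  ∀ (a : Fin n → ℚ) (b : Fin n → ℤ) (A : Fin n → ℝ) (B : ℝ) (k₀ : Fin n),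
    (∀ j, 0 < a j) →
    (∀ μ : Fin n → ℤ, ∏ j, a j ^ μ j = 1 → μ = 0) →
    (∀ κ : Fin n → ℤ, (∃ γ : ℚ, ∏ j, a j ^ κ j = γ ^ 2) → ∀ j, (2 : ℤ) ∣ κ j) →
    (∀ T : Finset (Fin n), T.Nonempty → ¬ IsSquare (∏ j ∈ T, a j)) →
    (∀ j, Height.logHeight₁ (a j) ≤ A j) → (∀ j, 1 ≤ A j) →
    (∀ j, b j ≠ 0) → Finset.univ.gcd b = 1 → Monotone A → (∀ j, A j ≤ A k₀) →
    (∀ j, (|b j| : ℝ) * A j ≤ B * A k₀) →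
    ¬ -(C n * (∏ j, A j) * Real.log (Real.exp 1 * B)) ≤
        Real.log |∑ j, (b j : ℝ) * Real.log (a j : ℝ)| →
    C n * (∏ j, A j) * Real.log (Real.exp 1 * B) < ∑ j, A j * |(b j : ℝ)| + Real.log 2 →
    ∃ (j₀ : Fin n) (D₀ S₀ X : ℕ) (D : Fin n → ℕ), b j₀ ≠ 0 ∧
      FrameOutputTwo n a b j₀ D₀ S₀ X D ∧ RecordArchW C Y n A D₀ S₀ X D

/-- **The Kummer-carrying dichotomy from the design-B frame.**  Reductions (`dichotomyArchWK_of_reduced`); zero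
estimate + frame output ⇒ END with exits for rational generators (`GenThreeEndExits.exists_exits_rat` on
`𝔚 = bHyperplane b`); exits A / full rank refuted by the record; exit C with `0 < r < n` = `stepArchWK_of_exitC`.
[cite: Nesterenko2003, §5.2] -/
theorem dichotomyArchWK_of_frameRat (hZ : Nesterenko2003_prop51) {C Y : ℕ → ℝ} (hC0 : ∀ r, 0 ≤ C r)
    (hCmono : ∀ r, r < n → C r ≤ C n) (hF : FrameArchWKRat C Y n) : DichotomyArchWK C n := by
  classical
  refine dichotomyArchWK_of_reduced (hC0 n) hCmono ?_
  intro a b A B k₀ ha hind hK hT hA hA1 hbz hgcd hmono hmax hBw hneg hreg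
  obtain ⟨j₀, D₀, S₀, X, D, hbj₀, hout, hrecA, hrecB, hrecC, hrecN⟩ :=
    hF a b A B k₀ ha hind hK hT hA hA1 hbz hgcd hmono hmax hBw hneg hreg
  obtain ⟨I, q, i₀, ha', hκ, hi₀, hq, hL⟩ := hout
  have ha0 : ∀ j, a j ≠ 0 := fun j => (ha j).ne'
  have hinj : Set.InjOn (fun i : ℕ × (Fin n → ℤ) => (i.1, i.2)) (I : Set (ℕ × (Fin n → ℤ))) := by
    intro x _ y _ h
    exact Prod.ext (congrArg Prod.fst h) (congrArg Prod.snd h)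
  obtain ⟨H, r, M, hrn, hd, hM, hchars, hexits⟩ :=
    exists_exits_rat hZ a ha0 hind b j₀ hbj₀ (bHyperplane b) (mem_bHyperplane b) I Prod.fst Prod.snd q
      D₀ S₀ X D ha' hκ hinj hi₀ hq hL
  have hb : b ≠ 0 := fun h0 => hbj₀ (by rw [h0]; rfl)
  rcases hexits with ⟨_hnex, hineqA⟩ | ⟨hex, hineqC⟩
  · exact absurd hineqA (hrecA r H.addDim M hrn hd hM)
  · rcases Nat.lt_or_ge r n with hlt | hge
    · have hr0 : 0 < r := pos_of_exitC b hb (fun i => M i) hex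
      have hbM := span_rat_of_exitC b (fun i => M i) hex
      obtain ⟨hYpos, hYC1, hYC2⟩ := hrecN r hr0 hlt
      exact stepArchWK_of_exitC hr0 hlt (hC0 r) a ha hind hK A hA hA1 b k₀ (hbz k₀) hBw H (fun i => M i) hM
        hchars hbM hreg hYpos hYC1 hYC2 (hrecC r H.addDim M hr0 hlt hd hM hineqC)
    · have hrn' : r = n := le_antisymm hrn hge
      subst hrn'
      exact absurd hineqC (hrecB H.addDim M hd hM)

/-- **STAGE-1 END-TO-END (`ArchCoreKummer`): the crux text `ArchCoreRat` with ONE extra 2-Kummer clause, from the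
zero estimate, `2 ≤ c`, a slack function `Y`, and the design-B archimedean frame at every rank `n ≥ 2`.**
[cite: Nesterenko2003, Thm 2.2 (p. 55); Matveev2000, Cor 2.3; shape only] -/
theorem archCoreKummer_of_frameWKRat_two_le_pow {c : ℝ} (hc : 2 ≤ c)
    (hF : Nesterenko2003_prop51 → ∀ n, 2 ≤ n → ∃ Y : ℕ → ℝ, FrameArchWKRat (fun r => c ^ r) Y n)
    (hZ : Nesterenko2003_prop51) :
    ∃ c : ℝ, ∀ (r : ℕ) (a : Fin r → ℚ) (b : Fin r → ℤ) (A : Fin r → ℝ) (B : ℝ),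
      (∀ i, 0 < a i) →
      (∀ μ : Fin r → ℤ, ∏ i, a i ^ μ i = 1 → μ = 0) →
      (∀ κ : Fin r → ℤ, (∃ γ : ℚ, ∏ i, a i ^ κ i = γ ^ 2) → ∀ i, (2 : ℤ) ∣ κ i) →
      (∀ i, Height.logHeight₁ (a i) ≤ A i) → (∀ i, 1 ≤ A i) →
      b ≠ 0 → (∀ i, (|b i| : ℝ) ≤ B) →
      -(c ^ r * (∏ i, A i) * Real.log (Real.exp 1 * B)) ≤
        Real.log |∑ i, (b i : ℝ) * Real.log (a i : ℝ)| := by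
  have hc1 : 1 ≤ c := by linarith
  have hCmono : Monotone (fun r : ℕ => c ^ r) := fun r s hrs => pow_le_pow_right₀ hc1 hrs
  refine archCoreKummer_of_coreWK (C := fun r => c ^ r) (c₁ := c) (fun r => ⟨by positivity, le_rfl⟩) hCmono ?_
  refine core_of_dichotomyWK (dichotomyArchWK_all (by simpa using hc) fun n hn => ?_)
  obtain ⟨Y, hFY⟩ := hF hZ n hn
  exact dichotomyArchWK_of_frameRat hZ (fun r => by positivity) (fun _ hr => hCmono hr.le) hFY

end Summit.ABC.StewartYu.GenThreeFrameSpecArchWK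

end
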